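import Literature.Dynamics.Tilings.BandTiling
import Literature.Dynamics.Tilings.Berger
import HarnessLib

/-!
# The Kari–Culik multiplication tile set tiles no cyclic band of more than `log₂ 3n` rows

Topic `Literature/Dynamics/Tilings`. Quantitative form of Jeandel–Vanier's Lemma 5 (LNM 2273,
§5.3; Kari 1996, Prop. 1) for the tree's Kari-type tile set `Kari.tileset` (all transitions of the
`×2` and `×(2/3)` Beatty transducers, `Literature/Barriers/AtomisticToContinuum/
AperiodicTilingGroundStatesProofs.lean`): not only does it tile no torus, it tiles no CYCLIC BAND
`ℤ/n × {0, …, m}` (`WangTileSet.IsBandTiling`, `BandTiling.lean`) as soon as `2^m > 3n`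
(`not_isBandTiling_kari`).

Proof (rows increase southward, as in `IsBandTiling`): on a cyclic row all tiles belong to one
transducer (the carry colours of the two are disjoint) and the carries telescope, so the digit
sums `S_r = Σ_{c<n} south (g c r) ∈ [n, 3n]` of consecutive rows satisfy `2 S_{r+1} = S_r`
(a `×2` row: its outputs, on the north edges, are the inputs of the row above) or
`2 S_{r+1} = 3 S_r` (a `×(2/3)` row); hence `2^m S_m = 3^b S_0`, so `2^m ∣ S_0 ≤ 3n`.

References: E. Jeandel, P. Vanier, *The undecidability of the Domino Problem*, LNM 2273 (2020),
§5.3 Lemma 5; J. Kari, *A small aperiodic set of Wang tiles*, Discrete Math. 160 (1996), Prop. 1.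
-/

namespace Literature.Dynamics.Tilings

namespace KariBand

open Literature.Barriers.AtomisticToContinuum.WangLatticeGas
open Literature.Barriers.AtomisticToContinuum.WangLatticeGas.Kari

variable {x : ℤ → ℕ → tileset}

/-! ### One transducer per cyclic row -/

/-- Horizontally matching tiles belong to the same transducer (the carry colours `≤ 0` of the
`×2` transducer and `≥ 4` of the `×(2/3)` transducer are disjoint). [cite: Kari1996, §2 (p. 260)] -/
theorem isMul2_iff_of_east_eq_west {s s' : tileset} (he : s.1.east = s'.1.west) :
    IsMul2 s.1 ↔ IsMul2 s'.1 := by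
  have he' : (s.1.east).1 = (s'.1.west).1 := congrArg Subtype.val he
  have hexcl : ∀ t : WangTile Col, IsMul23 t → ¬ IsMul2 t := fun t h h' => by
    obtain ⟨-, -, -, -, h5, -, -⟩ := h
    obtain ⟨-, -, -, -, h5', -, -⟩ := h'
    omega
  rcases mem_tileset.1 s.2 with h1 | h1 <;> rcases mem_tileset.1 s'.2 with h2 | h2
  · exact iff_of_true h1 h2
  · obtain ⟨-, -, -, -, -, h6, -⟩ := h1
    obtain ⟨-, -, -, -, h5, -, -⟩ := h2
    omega
  · obtain ⟨-, -, -, -, -, h6, -⟩ := h1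
    obtain ⟨-, -, -, -, h5, -, -⟩ := h2
    omega
  · exact iff_of_false (hexcl _ h1) (hexcl _ h2)

/-- Along a horizontally matching row the transducer does not change (columns `0, 1, 2, …`).
[cite: Kari1996, §2 (p. 260)] -/
theorem isMul2_iff_zero {r : ℕ} (hh : ∀ c : ℤ, (x c r).1.east = (x (c + 1) r).1.west) (k : ℕ) :
    IsMul2 (x k r).1 ↔ IsMul2 (x 0 r).1 := by
  induction k with
  | zero => simp
  | succ k ih =>
    rw [← ih]
    push_cast
    exact (isMul2_iff_of_east_eq_west (hh k)).symm

/-! ### Row sums -/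

/-- The sum of one edge colour over the columns `0, …, n - 1` of row `r`. [cite: Kari1996, §2 Proposition 1] -/
def rowSum (x : ℤ → ℕ → tileset) (e : WangTile Col → Col) (n r : ℕ) : ℤ :=
  ∑ k ∈ Finset.range n, (e (x k r).1).1

/-- Over a horizontal period the outward and the inward carries have the same sum (telescoping).
[cite: JeandelVanier2020, §5.3 Lemma 5] -/
theorem rowSum_east_eq_west {n r : ℕ} (hh : ∀ c : ℤ, (x c r).1.east = (x (c + 1) r).1.west)
    (hper : x n r = x 0 r) : rowSum x WangTile.east n r = rowSum x WangTile.west n r := by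
  unfold rowSum
  have h1 : ∀ k ∈ Finset.range n,
      ((x (k : ℤ) r).1.east).1 = ((x (((k + 1 : ℕ) : ℤ)) r).1.west).1 := fun k _ => by
    push_cast
    exact congrArg Subtype.val (hh k)
  rw [Finset.sum_congr rfl h1]
  exact sum_range_succ_shift (f := fun k : ℕ => ((x (k : ℤ) r).1.west).1) (by simp [hper])

/-- A row of `×2`-transitions: summing `2a + s = b + s'`. [cite: Kari1996, §2 Proposition 1] -/
theorem rowSum_rel2 {n r : ℕ} (hrow : ∀ k : ℕ, IsMul2 (x k r).1) :
    2 * rowSum x WangTile.south n r + rowSum x WangTile.west n r =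
      rowSum x WangTile.north n r + rowSum x WangTile.east n r := by
  unfold rowSum
  rw [Finset.mul_sum, ← Finset.sum_add_distrib, ← Finset.sum_add_distrib]
  exact Finset.sum_congr rfl fun k _ => (hrow k).2.2.2.2.2.2

/-- A row of `×(2/3)`-transitions: summing `2a + w = 3b + e`. [cite: Kari1996, §2 Proposition 1] -/
theorem rowSum_rel23 {n r : ℕ} (hrow : ∀ k : ℕ, IsMul23 (x k r).1) :
    2 * rowSum x WangTile.south n r + rowSum x WangTile.west n r =
      3 * rowSum x WangTile.north n r + rowSum x WangTile.east n r := by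
  unfold rowSum
  rw [Finset.mul_sum, Finset.mul_sum, ← Finset.sum_add_distrib, ← Finset.sum_add_distrib]
  exact Finset.sum_congr rfl fun k _ => (hrow k).2.2.2.2.2.2

/-- Vertical matching: the north digits of row `r + 1` are the south digits of row `r` (rows
increase southward). [cite: JeandelVanier2020, §5.3] -/
theorem rowSum_north_succ {n r : ℕ} (hv : ∀ c : ℤ, (x c r).1.south = (x c (r + 1)).1.north) :
    rowSum x WangTile.north n (r + 1) = rowSum x WangTile.south n r :=
  Finset.sum_congr rfl fun k _ => (congrArg Subtype.val (hv k)).symm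

/-- The input digits are `≥ 1`: the digit sum of a row is `≥ n`. [cite: JeandelVanier2020, §5.3 Lemma 5] -/
theorem le_rowSum_south (x : ℤ → ℕ → tileset) (n r : ℕ) :
    (n : ℤ) ≤ rowSum x WangTile.south n r := by
  unfold rowSum
  have h1 : ∀ k ∈ Finset.range n, (1 : ℤ) ≤ ((x (k : ℤ) r).1.south).1 := fun k _ => by
    rcases mem_tileset.1 (x k r).2 with h | h
    · exact h.1
    · exact h.1
  calc (n : ℤ) = ∑ _k ∈ Finset.range n, (1 : ℤ) := by simp
    _ ≤ _ := Finset.sum_le_sum h1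

/-- The input digits are `≤ 3`: the digit sum of a row is `≤ 3n`. [cite: JeandelVanier2020, §5.3] -/
theorem rowSum_south_le (x : ℤ → ℕ → tileset) (n r : ℕ) :
    rowSum x WangTile.south n r ≤ 3 * n := by
  unfold rowSum
  have h1 : ∀ k ∈ Finset.range n, ((x (k : ℤ) r).1.south).1 ≤ (3 : ℤ) := fun k _ => by
    rcases mem_tileset.1 (x k r).2 with h | h
    · exact h.2.1.trans (by norm_num)
    · exact h.2.1
  calc _ ≤ ∑ _k ∈ Finset.range n, (3 : ℤ) := Finset.sum_le_sum h1
    _ = 3 * n := by simp [mul_comm]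

/-! ### No band tiling of more than `log₂ 3n` rows -/

/-- **One step down the band**: if rows `r` and `r + 1` match vertically and row `r + 1` is a
cyclic row (horizontally matching, `n`-periodic), then `2 S_{r+1} = S_r` or `2 S_{r+1} = 3 S_r`
for the digit sums. [cite: JeandelVanier2020, §5.3 Lemma 5] -/
theorem two_mul_rowSum_succ {n r : ℕ} (hh : ∀ c : ℤ, (x c (r + 1)).1.east = (x (c + 1) (r + 1)).1.west)
    (hper : x n (r + 1) = x 0 (r + 1)) (hv : ∀ c : ℤ, (x c r).1.south = (x c (r + 1)).1.north) :
    2 * rowSum x WangTile.south n (r + 1) = rowSum x WangTile.south n r ∨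
      2 * rowSum x WangTile.south n (r + 1) = 3 * rowSum x WangTile.south n r := by
  have hEW := rowSum_east_eq_west hh hper
  have hN := rowSum_north_succ (n := n) hv
  by_cases h0 : IsMul2 (x 0 (r + 1)).1
  · left
    have hrel := rowSum_rel2 (n := n) (fun k => (isMul2_iff_zero hh k).2 h0)
    linarith
  · right
    have hrel := rowSum_rel23 (n := n) (fun k => (mem_tileset.1 (x k (r + 1)).2).resolve_left
      fun h => h0 ((isMul2_iff_zero hh k).1 h))
    linarith

/-- **The Kari–Culik tile set tiles no cyclic band of height `m + 1` with `2^m > 3n`** (`n ≥ 1`):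
`2^m S_m = 3^b S_0` forces `2^m ∣ S_0 ≤ 3n`. [cite: JeandelVanier2020, §5.3 Lemma 5] -/
theorem not_isBandTiling_kari {n m : ℕ} (hn : 1 ≤ n) (hm : 3 * n < 2 ^ m) (g : ℤ → ℕ → tileset) :
    ¬ (WangTileSet.ofFinset tileset).IsBandTiling n m g := by
  rintro ⟨hper, hh, hv⟩
  -- the digit sums and the one-step relation
  set S : ℕ → ℤ := fun r => rowSum g WangTile.south n r with hS
  have hstep : ∀ r < m, 2 * S (r + 1) = S r ∨ 2 * S (r + 1) = 3 * S r := by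
    intro r hr
    have hper' : g n (r + 1) = g 0 (r + 1) := by simpa using hper 0 (r + 1)
    exact two_mul_rowSum_succ (fun c => hh c (r + 1) (Nat.succ_le_of_lt hr)) hper'
      (fun c => hv c r hr)
  -- `2^r S_r = 3^b S_0`
  have hiter : ∀ r ≤ m, ∃ b : ℕ, (2 : ℤ) ^ r * S r = 3 ^ b * S 0 := by
    intro r
    induction r with
    | zero => intro _; exact ⟨0, by simp⟩
    | succ r ih =>
      intro hr
      obtain ⟨b, hb⟩ := ih (Nat.le_of_succ_le hr)
      rcases hstep r (Nat.lt_of_succ_le hr) with h | h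
      · refine ⟨b, ?_⟩
        rw [pow_succ, ← hb]
        linear_combination (2 : ℤ) ^ r * h
      · refine ⟨b + 1, ?_⟩
        rw [pow_succ, pow_succ]
        linear_combination (2 : ℤ) ^ r * h + 3 * hb
  obtain ⟨b, hb⟩ := hiter m le_rfl
  -- positivity and the bound `S_0 ≤ 3n`
  have hS0 : (n : ℤ) ≤ S 0 := le_rowSum_south g n 0
  have hSm : (n : ℤ) ≤ S m := le_rowSum_south g n m
  have hS0' : S 0 ≤ 3 * n := rowSum_south_le g n 0
  obtain ⟨s0, hs0⟩ : ∃ s0 : ℕ, S 0 = s0 := ⟨(S 0).toNat, (Int.toNat_of_nonneg (by linarith)).symm⟩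
  obtain ⟨sm, hsm⟩ : ∃ sm : ℕ, S m = sm := ⟨(S m).toNat, (Int.toNat_of_nonneg (by linarith)).symm⟩
  rw [hs0, hsm] at hb
  have hbN : 2 ^ m * sm = 3 ^ b * s0 := by exact_mod_cast hb
  have hdvd : 2 ^ m ∣ s0 * 3 ^ b := ⟨sm, by rw [mul_comm s0, ← hbN]⟩
  have hcop : Nat.Coprime (2 ^ m) (3 ^ b) := Nat.Coprime.pow _ _ (by decide)
  have hdvd' : 2 ^ m ∣ s0 := hcop.dvd_of_dvd_mul_right hdvd
  have hs0pos : 0 < s0 := by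
    have : (1 : ℤ) ≤ s0 := by rw [← hs0]; exact le_trans (by exact_mod_cast hn) hS0
    exact_mod_cast this
  have hle : 2 ^ m ≤ s0 := Nat.le_of_dvd hs0pos hdvd'
  have hs03 : s0 ≤ 3 * n := by
    have : (s0 : ℤ) ≤ 3 * n := by rw [← hs0]; exact hS0'
    exact_mod_cast this
  omega

end KariBand

end Literature.Dynamics.Tilings
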